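import Summits.QuantumFields.BalabanUV.Beta.D1BFx.WardJetsUnpacked

/-!
# `BalabanUV.Beta.D1BFx.WardJetsCombSources` — road «BF-x» for binder row D1, slot (K), TB4 brick **K-TA4W** (staged companion 3 of the ONE module `WardJetsFromNoether`, filed only under the row owner's (R1)):
# the KKT SOURCE CONDITIONS of `WardJetsUnpacked.ward₁`∕`ward₂` DISCHARGED for the packed columns of an honest inverse of the
# comb-gauged bordered matrix `M = kkt K₀ [Q₀; τ]` (TB1's `M_T`): the comb-multiplier response to any field-free source vanishes

HONEST DEPENDENCY (cell records, verbatim): «continuum YM on T⁴ ⇐ BetaPertH ∧ nine spine estimates (0/9 proved); BetaPertH ⇐ (D1) ∧ (D4) ∧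
CAP+tail; G-an2-4 gates asym, D1 and NE2/3/4.»  HONEST FRAMING (cell contract, verbatim): «discharging `BetaPertH` makes Bałaban's UV stability
UNCONDITIONAL — a real constructive-QFT result; it is NOT the continuum limit and NOT the Clay problem.»  THIS MODULE DISCHARGES NOTHING of (K),
of D1 or of the wall: [folklore] finite-dimensional matrix algebra over ABSTRACT data; no definition, no `def … : Prop`, nothing cited,
0 sorry.  NOT D1, NOT BetaPertH, NOT continuum, NOT Clay.

ABSOLUTE RULE (cell charter, verbatim): «No internally-minted statement may enter as a cited fact. Every hypothesis is either kernel-proved in this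
package or a verbatim quotation of a PUBLISHED theorem with page reference. The manuscript(s) under audit are NOT citable for their own disputed
steps — they are the thing under adjudication; programme-internal (2001/route/tribunal) claims are never citable.»

WHY (K-ASSEMBLY-SPEC v2 §0∕§3; `MixedVarPackedHess` §2–§4; TB1 `TorusCombKKT.inv_MT_packed_eq`).  On each torus the leg of the literal is the PACKED
`(ν ⊕ μ)`-block `X.submatrix e e` (`e = Sum.map id Sum.inl`) of an honest inverse `X` of the comb-gauged sharp bordered matrix
`M = kkt K₀ (fromRows Q₀ τ)` on `ν ⊕ (μ ⊕ ρ)`; the first response to the prescribed coarse bond `s` is the packed column of `X` at the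
coarse source `inr (inl s)`, the second response is `−X_pack·𝕄_t·r_s` (`SecondOrderResponse.K2OfK = −K∘(∂𝕄)∘K`).  `WardJetsUnpacked.ward₁`∕
`ward₂` ask that the FIELD rows of `kkt K₀ Q₀ *ᵥ r_s` and of `kkt K₀ Q₀ *ᵥ r_st + 𝕄_t *ᵥ r_s` vanish.  For the honest comb-gauged inverse
this is NOT automatic (the field rows of `M·x = e_{source}` carry the comb term `τᵀ·x_ρ`); it follows from the ORDER-ZERO Ward letters
`K₀ᵀ·W₀ = 0`, `Q₀·W₀ = 0` and the comb non-degeneracy `IsUnit (τ·W₀).det` — the comb multiplier of a gauge-INVARIANT source vanishes —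
and, at order two, from the order-one `ᵀ`-Ward of the `t`-jet.  That is this file.

CONTENT (all [folklore]).
* §1 ROW READ-OUTS of `kkt K₀ (fromRows Q₀ τ)`: field rows of `M *ᵥ x` = `K₀·x_ν + Q₀ᵀ·x_μ + τᵀ·x_ρ` (`combKKT_mulVec_inl`), field rows of
  `M * X` blockwise (`combKKT_mul_submatrix_inl`), coarse rows (`combKKT_mul_submatrix_inr_inl`); columns of a product as `mulVec` (`mulVec_col`).
* §2 **`comb_rows_eq_zero`**: `K₀ᵀW₀ = 0`, `Q₀W₀ = 0`, `IsUnit (τW₀).det`, field rows of `M *ᵥ x` vanish ⟹ the comb rows of `x` vanish.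
  **`field_rows_packed_col`**: hence for `M·X = 1` and ANY non-field source `b : μ ⊕ ρ`, the packed column `r i := X (e i) (inr b)` has
  vanishing field rows of `kkt K₀ Q₀ *ᵥ r` — the order-one source hypothesis of `ward₁`.
* §3 **`comb_block_mulVec_eq_zero`**: for `M·X = 1` the comb-row∕field-column block of `X` kills every field vector `v` with `W₀ᵀ·v = 0`
  (`(τW₀)ᵀ·X_ρν = W₀ᵀ` from the field-source columns).  **`transpose_W₀_mulVec_tjet_eq_zero`**: the order-one `ᵀ`-Ward of the `t`-jet
  (`Kₜᵀ·W₀ + K₀ᵀ·Wₜ = 0`, `Qₜ·W₀ + Q₀·Wₜ = 0`) makes `W₀ᵀ·(field rows of 𝕄_t·r_s)` vanish.  **`field_rows_second`**: hence the order-two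
  source hypothesis of `ward₂` for `r_st := −(X_pack *ᵥ (𝕄_t *ᵥ r_s))`.
NOT HERE: which `W₀` (root-vanishing vs block-mean-free gauge functions — Q-g6-2), periodisation, the cell's tables.
Provenance: D1 formalisation swarm leaf seat `b2b-balaban-beta-d1-formalise-leaf-05` gen 11 (road «BF-x» brick K-TA4W), 2026-08-20.
-/

noncomputable section

namespace Summit.QuantumFields.BalabanUV.Beta.D1BFx.WardJetsCombSources

open Matrix
open scoped BigOperators
open Literature.MathematicalPhysics.QuantumFieldTheory.Balaban1983to89.Beta.Composition (kkt)

variable {ν μ ρ : Type*} [Fintype ν] [Fintype μ] [Fintype ρ] [DecidableEq ν] [DecidableEq μ] [DecidableEq ρ]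

/-! ## §1 Row read-outs of the comb-gauged bordered matrix -/

omit [Fintype ν] [DecidableEq ν] [DecidableEq μ] [DecidableEq ρ] in
/-- [folklore] The FIELD rows of `kkt K₀ [Q₀; τ] *ᵥ x`: `K₀·x_ν + Q₀ᵀ·x_μ + τᵀ·x_ρ`. -/
theorem combKKT_mulVec_inl [Fintype ν] (K₀ : Matrix ν ν ℝ) (Q₀ : Matrix μ ν ℝ) (τ : Matrix ρ ν ℝ) (x : ν ⊕ (μ ⊕ ρ) → ℝ) (i : ν) :
    (kkt K₀ (fromRows Q₀ τ) *ᵥ x) (Sum.inl i)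
      = (K₀ *ᵥ fun j => x (Sum.inl j)) i + (Q₀ᵀ *ᵥ fun m => x (Sum.inr (Sum.inl m))) i
        + (τᵀ *ᵥ fun p => x (Sum.inr (Sum.inr p))) i := by
  simp [kkt, Matrix.mulVec, dotProduct, Matrix.fromBlocks, Matrix.fromRows, Fintype.sum_sum_type, add_assoc]

omit [DecidableEq ν] [DecidableEq μ] [DecidableEq ρ] in
/-- [folklore] The FIELD rows of `kkt K₀ [Q₀; τ] * X`, any column reindexing `f`: `K₀·X_ν + Q₀ᵀ·X_μ + τᵀ·X_ρ`. -/
theorem combKKT_mul_submatrix_inl {γ γ' : Type*} (K₀ : Matrix ν ν ℝ) (Q₀ : Matrix μ ν ℝ) (τ : Matrix ρ ν ℝ)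
    (X : Matrix (ν ⊕ (μ ⊕ ρ)) γ ℝ) (f : γ' → γ) :
    (kkt K₀ (fromRows Q₀ τ) * X).submatrix Sum.inl f
      = K₀ * X.submatrix Sum.inl f + Q₀ᵀ * X.submatrix (Sum.inr ∘ Sum.inl) f + τᵀ * X.submatrix (Sum.inr ∘ Sum.inr) f := by
  ext i c
  simp [kkt, Matrix.mul_apply, Matrix.fromBlocks, Matrix.fromRows, Fintype.sum_sum_type, add_assoc]

omit [DecidableEq ν] [DecidableEq μ] [DecidableEq ρ] in
/-- [folklore] The COARSE rows of `kkt K₀ [Q₀; τ] * X`: `Q₀·X_ν`. -/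
theorem combKKT_mul_submatrix_inr_inl {γ γ' : Type*} (K₀ : Matrix ν ν ℝ) (Q₀ : Matrix μ ν ℝ) (τ : Matrix ρ ν ℝ)
    (X : Matrix (ν ⊕ (μ ⊕ ρ)) γ ℝ) (f : γ' → γ) :
    (kkt K₀ (fromRows Q₀ τ) * X).submatrix (Sum.inr ∘ Sum.inl) f = Q₀ * X.submatrix Sum.inl f := by
  ext m c
  simp [kkt, Matrix.mul_apply, Matrix.fromBlocks, Matrix.fromRows, Fintype.sum_sum_type]

omit [Fintype μ] [Fintype ρ] [DecidableEq ν] [DecidableEq μ] [DecidableEq ρ] in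
/-- [folklore] A column of a product is the product acting on the column. -/
theorem mulVec_col {α β γ : Type*} [Fintype β] (A : Matrix α β ℝ) (X : Matrix β γ ℝ) (c : γ) :
    (A *ᵥ fun k => X k c) = fun i => (A * X) i c := by
  ext i
  simp [Matrix.mulVec, dotProduct, Matrix.mul_apply]

/-! ## §2 The comb response to a field-free source vanishes; the order-one source condition -/

omit [DecidableEq ν] [DecidableEq μ] in
/-- [folklore] **THE COMB MULTIPLIER OF A GAUGE-INVARIANT SOURCE VANISHES.**  If `K₀ᵀ·W₀ = 0`, `Q₀·W₀ = 0` (order-zero Ward letters),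
`τ·W₀` is invertible (the comb rows are a gauge), and the FIELD rows of `kkt K₀ [Q₀; τ] *ᵥ x` vanish (the source of `x` sits in the
coarse∕comb rows), then the comb components of `x` vanish: `W₀ᵀ·(K₀x_ν + Q₀ᵀx_μ + τᵀx_ρ) = (τW₀)ᵀ·x_ρ = 0`. -/
theorem comb_rows_eq_zero (K₀ : Matrix ν ν ℝ) (Q₀ : Matrix μ ν ℝ) (τ : Matrix ρ ν ℝ) (W₀ : Matrix ν ρ ℝ)
    (a0t : K₀ᵀ * W₀ = 0) (b0 : Q₀ * W₀ = 0) (hτ : IsUnit (τ * W₀).det)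
    (x : ν ⊕ (μ ⊕ ρ) → ℝ) (hx : ∀ i : ν, (kkt K₀ (fromRows Q₀ τ) *ᵥ x) (Sum.inl i) = 0) :
    (fun p => x (Sum.inr (Sum.inr p))) = 0 := by
  set xν : ν → ℝ := fun j => x (Sum.inl j)
  set xμ : μ → ℝ := fun m => x (Sum.inr (Sum.inl m))
  set xρ : ρ → ℝ := fun p => x (Sum.inr (Sum.inr p))
  have hrow : K₀ *ᵥ xν + Q₀ᵀ *ᵥ xμ + τᵀ *ᵥ xρ = 0 := by
    ext i
    have := hx i
    rw [combKKT_mulVec_inl] at this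
    simpa [Pi.add_apply] using this
  have hK : W₀ᵀ * K₀ = 0 := by simpa using congrArg Matrix.transpose a0t
  have hQ : W₀ᵀ * Q₀ᵀ = 0 := by simpa using congrArg Matrix.transpose b0
  have hτW : (τ * W₀)ᵀ *ᵥ xρ = 0 := by
    have h := congrArg (fun v => W₀ᵀ *ᵥ v) hrow
    simp only [Matrix.mulVec_add, Matrix.mulVec_mulVec, hK, hQ, Matrix.zero_mulVec, zero_add, Matrix.mulVec_zero] at h
    rwa [Matrix.transpose_mul]
  have hunit : IsUnit (τ * W₀)ᵀ.det := Matrix.isUnit_det_transpose _ hτ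
  calc xρ = ((τ * W₀)ᵀ⁻¹ * (τ * W₀)ᵀ) *ᵥ xρ := by rw [Matrix.nonsing_inv_mul _ hunit, Matrix.one_mulVec]
    _ = 0 := by rw [← Matrix.mulVec_mulVec, hτW, Matrix.mulVec_zero]

/-- [folklore] **THE ORDER-ONE SOURCE CONDITION FOR THE PACKED COLUMNS OF AN HONEST COMB-GAUGED INVERSE.**  `M·X = 1` with
`M = kkt K₀ [Q₀; τ]`, the order-zero letters and `IsUnit (τW₀).det`: for every NON-FIELD source `b : μ ⊕ ρ` the packed column
`r i := X (e i) (inr b)` (`e = Sum.map id Sum.inl`) has vanishing FIELD rows of `kkt K₀ Q₀ *ᵥ r` — the `hsrc` of `WardJetsUnpacked.ward₁`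
(on the road `b = inl s`, a prescribed coarse bond). Also recorded: the comb rows of that column vanish. -/
theorem field_rows_packed_col (K₀ : Matrix ν ν ℝ) (Q₀ : Matrix μ ν ℝ) (τ : Matrix ρ ν ℝ) (W₀ : Matrix ν ρ ℝ)
    (a0t : K₀ᵀ * W₀ = 0) (b0 : Q₀ * W₀ = 0) (hτ : IsUnit (τ * W₀).det)
    (X : Matrix (ν ⊕ (μ ⊕ ρ)) (ν ⊕ (μ ⊕ ρ)) ℝ) (hMX : kkt K₀ (fromRows Q₀ τ) * X = 1) (b : μ ⊕ ρ) :
    (∀ p : ρ, X (Sum.inr (Sum.inr p)) (Sum.inr b) = 0)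
    ∧ ∀ i : ν, (kkt K₀ Q₀ *ᵥ fun k => X (Sum.map id Sum.inl k) (Sum.inr b)) (Sum.inl i) = 0 := by
  set x : ν ⊕ (μ ⊕ ρ) → ℝ := fun k => X k (Sum.inr b)
  have hx : ∀ i : ν, (kkt K₀ (fromRows Q₀ τ) *ᵥ x) (Sum.inl i) = 0 := by
    intro i
    rw [mulVec_col, hMX]
    exact Matrix.one_apply_ne Sum.inl_ne_inr
  have hρ := comb_rows_eq_zero K₀ Q₀ τ W₀ a0t b0 hτ x hx
  have hρ' : ∀ p : ρ, X (Sum.inr (Sum.inr p)) (Sum.inr b) = 0 := fun p => congrFun hρ p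
  refine ⟨hρ', fun i => ?_⟩
  have h := hx i
  rw [combKKT_mulVec_inl] at h
  rw [WardJetsFromNoether.kkt_mulVec_inl]
  have hz : (fun p => x (Sum.inr (Sum.inr p))) = 0 := hρ
  rw [hz, Matrix.mulVec_zero, Pi.zero_apply, add_zero] at h
  simpa [x] using h

/-! ## §3 The order-two source condition -/

/-- [folklore] **THE COMB BLOCK KILLS `W₀`-ORTHOGONAL FIELD VECTORS.**  For `M·X = 1` (`M = kkt K₀ [Q₀; τ]`) the field-source columns give
`K₀·X_νν + Q₀ᵀ·X_μν + τᵀ·X_ρν = 1`, whence `(τW₀)ᵀ·X_ρν = W₀ᵀ` by the order-zero letters; so `W₀ᵀ·v = 0` forces `X_ρν·v = 0`. -/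
theorem comb_block_mulVec_eq_zero (K₀ : Matrix ν ν ℝ) (Q₀ : Matrix μ ν ℝ) (τ : Matrix ρ ν ℝ) (W₀ : Matrix ν ρ ℝ)
    (a0t : K₀ᵀ * W₀ = 0) (b0 : Q₀ * W₀ = 0) (hτ : IsUnit (τ * W₀).det)
    (X : Matrix (ν ⊕ (μ ⊕ ρ)) (ν ⊕ (μ ⊕ ρ)) ℝ) (hMX : kkt K₀ (fromRows Q₀ τ) * X = 1)
    (v : ν → ℝ) (hv : W₀ᵀ *ᵥ v = 0) :
    X.submatrix (Sum.inr ∘ Sum.inr) Sum.inl *ᵥ v = 0 := by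
  have hblk : K₀ * X.submatrix Sum.inl Sum.inl + Q₀ᵀ * X.submatrix (Sum.inr ∘ Sum.inl) Sum.inl
      + τᵀ * X.submatrix (Sum.inr ∘ Sum.inr) Sum.inl = 1 := by
    rw [← combKKT_mul_submatrix_inl, hMX]
    ext i j
    simp [Matrix.one_apply]
  have hK : W₀ᵀ * K₀ = 0 := by simpa using congrArg Matrix.transpose a0t
  have hQ : W₀ᵀ * Q₀ᵀ = 0 := by simpa using congrArg Matrix.transpose b0
  have hcomb : (τ * W₀)ᵀ * X.submatrix (Sum.inr ∘ Sum.inr) Sum.inl = W₀ᵀ := by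
    have h := congrArg (fun A => W₀ᵀ * A) hblk
    simp only [Matrix.mul_add, ← Matrix.mul_assoc, hK, hQ, Matrix.zero_mul, zero_add, Matrix.mul_one] at h
    rwa [Matrix.transpose_mul]
  have hunit : IsUnit (τ * W₀)ᵀ.det := Matrix.isUnit_det_transpose _ hτ
  have h2 : (τ * W₀)ᵀ *ᵥ (X.submatrix (Sum.inr ∘ Sum.inr) Sum.inl *ᵥ v) = 0 := by
    rw [Matrix.mulVec_mulVec, hcomb, hv]
  calc X.submatrix (Sum.inr ∘ Sum.inr) Sum.inl *ᵥ v
      = ((τ * W₀)ᵀ⁻¹ * (τ * W₀)ᵀ) *ᵥ (X.submatrix (Sum.inr ∘ Sum.inr) Sum.inl *ᵥ v) := by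
        rw [Matrix.nonsing_inv_mul _ hunit, Matrix.one_mulVec]
    _ = 0 := by rw [← Matrix.mulVec_mulVec, h2, Matrix.mulVec_zero]

omit [Fintype μ] [Fintype ρ] [DecidableEq ν] [DecidableEq μ] [DecidableEq ρ] in
/-- [folklore] **THE ORDER-ONE `ᵀ`-WARD KILLS `W₀ᵀ` ON THE FIELD ROWS OF THE `t`-JET APPLIED TO A RESPONSE.**  If `Kₜᵀ·W₀ + K₀ᵀ·Wₜ = 0`,
`Qₜ·W₀ + Q₀·Wₜ = 0` (binders `aₜt`, `bₜ`) and the field rows of `kkt K₀ Q₀ *ᵥ r` vanish, then `W₀ᵀ·(Kₜ·r_ν + Qₜᵀ·r_μ) = −Wₜᵀ·(K₀·r_ν + Q₀ᵀ·r_μ) = 0`. -/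
theorem transpose_W₀_mulVec_tjet_eq_zero [Fintype μ] (K₀ Kₜ : Matrix ν ν ℝ) (Q₀ Qₜ : Matrix μ ν ℝ) (W₀ Wₜ : Matrix ν ρ ℝ)
    (aₜt : Kₜᵀ * W₀ + K₀ᵀ * Wₜ = 0) (bₜ : Qₜ * W₀ + Q₀ * Wₜ = 0)
    (r : ν ⊕ μ → ℝ) (hsrc : ∀ i : ν, (kkt K₀ Q₀ *ᵥ r) (Sum.inl i) = 0) :
    W₀ᵀ *ᵥ (fun i => (kkt Kₜ Qₜ *ᵥ r) (Sum.inl i)) = 0 := by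
  set rν : ν → ℝ := fun j => r (Sum.inl j)
  set rμ : μ → ℝ := fun m => r (Sum.inr m)
  have h0 : K₀ *ᵥ rν + Q₀ᵀ *ᵥ rμ = 0 := by
    ext i
    have := hsrc i
    rw [WardJetsFromNoether.kkt_mulVec_inl] at this
    simpa [Pi.add_apply] using this
  have ht : (fun i => (kkt Kₜ Qₜ *ᵥ r) (Sum.inl i)) = Kₜ *ᵥ rν + Qₜᵀ *ᵥ rμ := by
    ext i
    rw [WardJetsFromNoether.kkt_mulVec_inl]
    rfl
  have hK : W₀ᵀ * Kₜ = -(Wₜᵀ * K₀) := by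
    have h := congrArg Matrix.transpose aₜt
    simp only [Matrix.transpose_add, Matrix.transpose_mul, Matrix.transpose_transpose, Matrix.transpose_zero] at h
    exact eq_neg_of_add_eq_zero_left h
  have hQ : W₀ᵀ * Qₜᵀ = -(Wₜᵀ * Q₀ᵀ) := by
    have h := congrArg Matrix.transpose bₜ
    simp only [Matrix.transpose_add, Matrix.transpose_mul, Matrix.transpose_zero] at h
    exact eq_neg_of_add_eq_zero_left h
  rw [ht, Matrix.mulVec_add, Matrix.mulVec_mulVec, Matrix.mulVec_mulVec, hK, hQ, Matrix.neg_mulVec, Matrix.neg_mulVec,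
    ← neg_add, ← Matrix.mulVec_mulVec, ← Matrix.mulVec_mulVec, ← Matrix.mulVec_add, h0, Matrix.mulVec_zero, neg_zero]

/-- [folklore] **THE ORDER-TWO SOURCE CONDITION** (`hst` of `WardJetsUnpacked.ward₂`) for the honest comb-gauged inverse: with `M·X = 1`,
the order-zero letters, `IsUnit (τW₀).det`, and the order-one `ᵀ`-Ward of the `t`-jet `𝕄_t = kkt Kₜ Qₜ` (`Kₜᵀ·W₀ + K₀ᵀ·Wₜ = 0`,
`Qₜ·W₀ + Q₀·Wₜ = 0`), the first response `r i := X (e i) (inr (inl s))` to the coarse bond `s` and the second response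
`r_st := −(X_pack *ᵥ (𝕄_t *ᵥ r))` (`X_pack = X.submatrix e e`, `e = Sum.map id Sum.inl`; the `K2OfK = −K∘(∂𝕄)∘K` shape) satisfy:
the FIELD rows of `kkt K₀ Q₀ *ᵥ r_st + 𝕄_t *ᵥ r` vanish. -/
theorem field_rows_second (K₀ Kₜ : Matrix ν ν ℝ) (Q₀ Qₜ : Matrix μ ν ℝ) (τ : Matrix ρ ν ℝ) (W₀ Wₜ : Matrix ν ρ ℝ)
    (a0t : K₀ᵀ * W₀ = 0) (b0 : Q₀ * W₀ = 0) (hτ : IsUnit (τ * W₀).det)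
    (aₜt : Kₜᵀ * W₀ + K₀ᵀ * Wₜ = 0) (bₜ : Qₜ * W₀ + Q₀ * Wₜ = 0)
    (X : Matrix (ν ⊕ (μ ⊕ ρ)) (ν ⊕ (μ ⊕ ρ)) ℝ) (hMX : kkt K₀ (fromRows Q₀ τ) * X = 1) (s : μ)
    (r rst : ν ⊕ μ → ℝ) (hr : r = fun k => X (Sum.map id Sum.inl k) (Sum.inr (Sum.inl s)))
    (hrst : rst = -(X.submatrix (Sum.map id Sum.inl) (Sum.map id Sum.inl) *ᵥ (kkt Kₜ Qₜ *ᵥ r))) (i : ν) :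
    (kkt K₀ Q₀ *ᵥ rst + kkt Kₜ Qₜ *ᵥ r) (Sum.inl i) = 0 := by
  -- the `t`-jet applied to the first response, packed, and its field rows
  set v : ν ⊕ μ → ℝ := kkt Kₜ Qₜ *ᵥ r with hv
  set vν : ν → ℝ := fun j => v (Sum.inl j) with hvν
  -- (1) the first response has vanishing field KKT rows, hence `W₀ᵀ·v_ν = 0`
  have hsrc : ∀ j : ν, (kkt K₀ Q₀ *ᵥ r) (Sum.inl j) = 0 := by
    rw [hr]; exact (field_rows_packed_col K₀ Q₀ τ W₀ a0t b0 hτ X hMX (Sum.inl s)).2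
  have hW : W₀ᵀ *ᵥ vν = 0 := transpose_W₀_mulVec_tjet_eq_zero K₀ Kₜ Q₀ Qₜ W₀ Wₜ aₜt bₜ r hsrc
  -- (2) the comb block of `X` kills `v_ν`, and the comb rows of the coarse-source columns of `X` vanish
  have hcombν : X.submatrix (Sum.inr ∘ Sum.inr) Sum.inl *ᵥ vν = 0 :=
    comb_block_mulVec_eq_zero K₀ Q₀ τ W₀ a0t b0 hτ X hMX vν hW
  have hcombμ : ∀ (p : ρ) (m : μ), X (Sum.inr (Sum.inr p)) (Sum.inr (Sum.inl m)) = 0 := fun p m =>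
    (field_rows_packed_col K₀ Q₀ τ W₀ a0t b0 hτ X hMX (Sum.inl m)).1 p
  -- (3) field row `i` of `kkt K₀ Q₀ · X_pack · v` is `v (inl i)` minus the comb correction, which vanishes by (2)
  have hrow : (kkt K₀ Q₀ *ᵥ (X.submatrix (Sum.map id Sum.inl) (Sum.map id Sum.inl) *ᵥ v)) (Sum.inl i) = v (Sum.inl i) := by
    -- row `inl i` of `M·X = 1` against the packed vector `v` extended by zero comb components
    have h1 : ∀ c, (kkt K₀ (fromRows Q₀ τ) * X) (Sum.inl i) c = (1 : Matrix (ν ⊕ (μ ⊕ ρ)) (ν ⊕ (μ ⊕ ρ)) ℝ) (Sum.inl i) c := fun c => by rw [hMX]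
    have key : ∀ c, ∑ j, K₀ i j * X (Sum.inl j) c + ∑ m, Q₀ m i * X (Sum.inr (Sum.inl m)) c
        = (1 : Matrix (ν ⊕ (μ ⊕ ρ)) (ν ⊕ (μ ⊕ ρ)) ℝ) (Sum.inl i) c - ∑ p, τ p i * X (Sum.inr (Sum.inr p)) c := by
      intro c
      have := h1 c
      simp only [Matrix.mul_apply, kkt, Matrix.fromBlocks, Matrix.fromRows, Fintype.sum_sum_type, Matrix.of_apply,
        Sum.elim_inl, Sum.elim_inr, Matrix.transpose_apply] at this
      linarith
    rw [Matrix.mulVec_mulVec]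
    simp only [Matrix.mulVec, dotProduct, Matrix.mul_apply, kkt, Matrix.fromBlocks, Fintype.sum_sum_type, Matrix.of_apply,
      Sum.elim_inl, Sum.elim_inr, Matrix.transpose_apply, Matrix.submatrix_apply, Sum.map_inl, Sum.map_inr, id_eq]
    -- regroup: for each packed column `c`, the inner sums are `key c`
    have e : ∀ c : ν ⊕ μ, (∑ j, K₀ i j * X (Sum.inl j) (Sum.map id Sum.inl c)
          + ∑ m, Q₀ m i * X (Sum.inr (Sum.inl m)) (Sum.map id Sum.inl c)) * v c
        = ((1 : Matrix (ν ⊕ (μ ⊕ ρ)) (ν ⊕ (μ ⊕ ρ)) ℝ) (Sum.inl i) (Sum.map id Sum.inl c)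
          - ∑ p, τ p i * X (Sum.inr (Sum.inr p)) (Sum.map id Sum.inl c)) * v c := fun c => by rw [key]
    have step : (∑ x, (∑ j, K₀ i j * X (Sum.inl j) (Sum.inl x) + ∑ m, Q₀ m i * X (Sum.inr (Sum.inl m)) (Sum.inl x)) * v (Sum.inl x))
        + (∑ x, (∑ j, K₀ i j * X (Sum.inl j) (Sum.inr (Sum.inl x))
            + ∑ m, Q₀ m i * X (Sum.inr (Sum.inl m)) (Sum.inr (Sum.inl x))) * v (Sum.inr x))
        = v (Sum.inl i) := by
      have e1 := fun x : ν => e (Sum.inl x)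
      have e2 := fun x : μ => e (Sum.inr x)
      simp only [Sum.map_inl, Sum.map_inr, id_eq] at e1 e2
      simp_rw [e1, e2]
      -- the comb corrections vanish: field columns by `hcombν`, coarse columns by `hcombμ`
      have c1 : ∑ x : ν, (∑ p, τ p i * X (Sum.inr (Sum.inr p)) (Sum.inl x)) * v (Sum.inl x) = 0 := by
        have hh : ∀ p, ∑ x : ν, X (Sum.inr (Sum.inr p)) (Sum.inl x) * vν x = 0 := fun p => by
          have := congrFun hcombν p
          simpa [Matrix.mulVec, dotProduct] using this
        calc ∑ x : ν, (∑ p, τ p i * X (Sum.inr (Sum.inr p)) (Sum.inl x)) * v (Sum.inl x)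
            = ∑ p, τ p i * ∑ x : ν, X (Sum.inr (Sum.inr p)) (Sum.inl x) * vν x := by
              simp only [Finset.sum_mul, Finset.mul_sum, hvν]
              rw [Finset.sum_comm]
              exact Finset.sum_congr rfl fun p _ => Finset.sum_congr rfl fun x _ => by ring
          _ = 0 := Finset.sum_eq_zero fun p _ => by rw [hh p, mul_zero]
      have c2 : ∑ x : μ, (∑ p, τ p i * X (Sum.inr (Sum.inr p)) (Sum.inr (Sum.inl x))) * v (Sum.inr x) = 0 :=
        Finset.sum_eq_zero fun x _ => by
          rw [Finset.sum_eq_zero fun p _ => by rw [hcombμ p x, mul_zero], zero_mul]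
      simp only [sub_mul, Finset.sum_sub_distrib, c1, c2, sub_zero]
      simp [Matrix.one_apply, Finset.sum_ite_eq]
    simpa [Finset.sum_add_distrib, add_mul] using step
  -- (4) assemble
  rw [Pi.add_apply, hrst, Matrix.mulVec_neg, Pi.neg_apply, hrow]
  simp [hv]

end Summit.QuantumFields.BalabanUV.Beta.D1BFx.WardJetsCombSources

end
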